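import Literature.GroupTheory.CombinatorialGroupTheory.BinaryProductChains
import HarnessLib

/-!
# The structure of a chain of formal and cancelling partners

Topic `Literature/GroupTheory/CombinatorialGroupTheory`.  Continuation of
`BinaryProductChains.lean` (Zieschang–Vogt–Coldewey, *Surfaces and Planar Discontinuous
Groups*, LNM 835 (1980), §5.3, proof of Thm. 5.3.2).  For a cyclically Nielsen reduced cyclic
product `U` with a pairing `bar` and a kernel slot `σ₀`, the chain `chain U bar σ₀` satisfies:

* it has even length `2 (clen + 1) ≥ 2`, starts with `σ₀`, ends with the kernel slot
  `chainEnd U bar σ₀ ≠ σ₀` (`isKernelSlot_chainEnd`, `chainEnd_ne`, `getLast_chain`), all its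
  entries are slots and all interior entries are head or tail slots
  (`isKernelSlot_getElem_chain_iff`);
* alternation: each odd entry is the formal partner of its predecessor, each even entry after
  the first is the cancelling partner of its predecessor (`getElem_chain_odd_eq_fpartner`,
  `cpartner_getElem_chain_odd`);
* letters alternate between the letter `z` of `σ₀` (even entries) and `z⁻¹` (odd entries)
  (`slotLetter_getElem_chain`), hence no slot is repeated (`nodup_chain`);
* the formal partner and the cancelling partner exchange the even and the odd part of the chain
  (`mem_chainEvens_iff_fpartner_mem_chainOdds`, `mem_chainEvens_iff_cget_mem_chainOdds`, …), the
  only kernel slots on it are its two ends;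
* walking from the far end retraces the chain: `clen (chainEnd σ₀) = clen σ₀`,
  `chainEnd (chainEnd σ₀) = σ₀`, `chain (chainEnd σ₀) = (chain σ₀).reverse`, and the two ends sit
  at different positions of the closed path (`kpos_chainEnd_ne`).

## References

* H. Zieschang, E. Vogt, H.-D. Coldewey, *Surfaces and Planar Discontinuous Groups*, LNM 835
  (1980), §5.3 (proof of Thm. 5.3.2). [ZieschangVogtColdewey1980]
-/

namespace Literature.GroupTheory.CombinatorialGroupTheory

open List

namespace CycFactors

variable {α : Type*} [DecidableEq α]

/-! ### The structure of a chain -/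

section chainAPI

variable {U : List (List (α × Bool))} {bar : ℕ → ℕ} {σ₀ : ℕ × ℕ}

/-- Minimality of `clen`: before the end, formal partners are not kernel slots. [folklore] -/
theorem not_isKernelSlot_fpartner_citer {i : ℕ} (hi : i < clen U bar σ₀) :
    ¬ IsKernelSlot U (fpartner U bar (citer U bar σ₀ i)) := fun hk =>
  Nat.find_min (⟨nslots U, Or.inr rfl⟩ :
    ∃ i, IsKernelSlot U (fpartner U bar (citer U bar σ₀ i)) ∨ i = nslots U) hi (Or.inl hk)

variable (h : CycNielsen U) (hU : U ≠ []) (hb : IsPairing U bar) (hσ₀ : IsKernelSlot U σ₀)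
include h hU hb hσ₀

/-- **Chains are short**: `clen < nslots U`. [cite: ZieschangVogtColdewey1980, proof of Thm. 5.3.2] -/
theorem clen_lt_nslots : clen U bar σ₀ < nslots U :=
  lt_nslots_of_good h hU hb hσ₀ fun _ hj => not_isKernelSlot_fpartner_citer hj

/-- **The far end of a chain is a kernel slot.** [cite: ZieschangVogtColdewey1980, proof of Thm. 5.3.2] -/
theorem isKernelSlot_chainEnd : IsKernelSlot U (chainEnd U bar σ₀) := by
  rcases Nat.find_spec (⟨nslots U, Or.inr rfl⟩ :
    ∃ i, IsKernelSlot U (fpartner U bar (citer U bar σ₀ i)) ∨ i = nslots U) with hk | he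
  · exact hk
  · exact absurd he (clen_lt_nslots h hU hb hσ₀).ne

/-- The even entries of a chain are slots. [folklore] -/
theorem isSlot_citer {i : ℕ} (hi : i ≤ clen U bar σ₀) : IsSlot U (citer U bar σ₀ i) :=
  (isSlot_citer_of_good h hU hb hσ₀ (fun _ hj => not_isKernelSlot_fpartner_citer hj) i hi).1

/-- The even entries of a chain other than `σ₀` are not kernel slots. [folklore] -/
theorem not_isKernelSlot_citer {i : ℕ} (h0 : 0 < i) (hi : i ≤ clen U bar σ₀) :
    ¬ IsKernelSlot U (citer U bar σ₀ i) :=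
  (isSlot_citer_of_good h hU hb hσ₀ (fun _ hj => not_isKernelSlot_fpartner_citer hj) i hi).2 h0

/-- The odd entries of a chain are slots. [folklore] -/
theorem isSlot_fpartner_citer {i : ℕ} (hi : i ≤ clen U bar σ₀) :
    IsSlot U (fpartner U bar (citer U bar σ₀ i)) :=
  hb.isSlot_fpartner (isSlot_citer h hU hb hσ₀ hi)

/-- The far end of a chain is a slot. [folklore] -/
theorem isSlot_chainEnd : IsSlot U (chainEnd U bar σ₀) := (isKernelSlot_chainEnd h hU hb hσ₀).1

/-- `citer` is injective along the chain. [folklore] -/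
theorem citer_injective {i j : ℕ} (hi : i ≤ clen U bar σ₀) (hj : j ≤ clen U bar σ₀)
    (he : citer U bar σ₀ i = citer U bar σ₀ j) : i = j :=
  citer_injOn_of_good h hU hb hσ₀ (fun _ hj => not_isKernelSlot_fpartner_citer hj) hi hj he

/-- The odd entries are injective along the chain. [folklore] -/
theorem fpartner_citer_injective {i j : ℕ} (hi : i ≤ clen U bar σ₀) (hj : j ≤ clen U bar σ₀)
    (he : fpartner U bar (citer U bar σ₀ i) = fpartner U bar (citer U bar σ₀ j)) : i = j :=
  citer_injective h hU hb hσ₀ hi hj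
    (hb.fpartner_inj (isSlot_citer h hU hb hσ₀ hi) (isSlot_citer h hU hb hσ₀ hj) he)

/-- **Alternation**: the entry after an odd entry is its cancelling partner.
[cite: ZieschangVogtColdewey1980, proof of Thm. 5.3.2] -/
theorem cpartner_fpartner_citer {i : ℕ} (hi : i < clen U bar σ₀) :
    cpartner U (fpartner U bar (citer U bar σ₀ i)) = some (citer U bar σ₀ (i + 1)) := by
  rw [citer_succ]
  exact cpartner_eq_some_cget (isSlot_fpartner_citer h hU hb hσ₀ hi.le)
    (not_isKernelSlot_fpartner_citer hi)

/-- The cancelling partner of an even entry (other than `σ₀`) is the previous odd entry.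
[folklore] -/
theorem cget_citer_succ {i : ℕ} (hi : i < clen U bar σ₀) :
    cget U (citer U bar σ₀ (i + 1)) = fpartner U bar (citer U bar σ₀ i) := by
  rw [citer_succ]
  exact (h.cget_spec hU (isSlot_fpartner_citer h hU hb hσ₀ hi.le)
    (not_isKernelSlot_fpartner_citer hi)).2.2

/-- **The letters along a chain, even entries**: all equal to the letter of `σ₀`.
[cite: ZieschangVogtColdewey1980, proof of Thm. 5.3.2] -/
theorem slotLetter_citer [Inhabited α] : ∀ {i : ℕ}, i ≤ clen U bar σ₀ →
    slotLetter U (citer U bar σ₀ i) = slotLetter U σ₀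
  | 0, _ => rfl
  | i + 1, hi => by
    rw [citer_succ, h.slotLetter_cget hU (isSlot_fpartner_citer h hU hb hσ₀ (Nat.le_of_succ_le hi))
      (not_isKernelSlot_fpartner_citer hi), hb.slotLetter_fpartner
      (isSlot_citer h hU hb hσ₀ (Nat.le_of_succ_le hi)), slotLetter_citer (Nat.le_of_succ_le hi)]
    simp

/-- **The letters along a chain, odd entries**: all equal to the inverse letter of `σ₀`.
[cite: ZieschangVogtColdewey1980, proof of Thm. 5.3.2] -/
theorem slotLetter_fpartner_citer [Inhabited α] {i : ℕ} (hi : i ≤ clen U bar σ₀) :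
    slotLetter U (fpartner U bar (citer U bar σ₀ i)) =
      ((slotLetter U σ₀).1, !(slotLetter U σ₀).2) := by
  rw [hb.slotLetter_fpartner (isSlot_citer h hU hb hσ₀ hi), slotLetter_citer h hU hb hσ₀ hi]

/-- The far end of a chain carries the inverse letter of `σ₀`. [folklore] -/
theorem slotLetter_chainEnd [Inhabited α] :
    slotLetter U (chainEnd U bar σ₀) = ((slotLetter U σ₀).1, !(slotLetter U σ₀).2) :=
  slotLetter_fpartner_citer h hU hb hσ₀ le_rfl

/-- Even and odd entries of a chain differ (they carry inverse letters). [folklore] -/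
theorem citer_ne_fpartner_citer {i j : ℕ} (hi : i ≤ clen U bar σ₀) (hj : j ≤ clen U bar σ₀) :
    citer U bar σ₀ i ≠ fpartner U bar (citer U bar σ₀ j) := by
  let _ : Inhabited α := ⟨((fac U σ₀.1)[σ₀.2]'hσ₀.1.2).1⟩
  intro he
  have e := congrArg (fun σ => (slotLetter U σ).2) he
  simp only [slotLetter_citer h hU hb hσ₀ hi, slotLetter_fpartner_citer h hU hb hσ₀ hj] at e
  revert e
  cases (slotLetter U σ₀).2 <;> simp

/-- **The two ends of a chain differ.** [cite: ZieschangVogtColdewey1980, proof of Thm. 5.3.2] -/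
theorem chainEnd_ne : chainEnd U bar σ₀ ≠ σ₀ := fun he =>
  citer_ne_fpartner_citer h hU hb hσ₀ (Nat.zero_le _) le_rfl he.symm

/-- The two ends of a chain sit at different positions of the closed path. [folklore] -/
theorem kpos_chainEnd_ne : kpos U (chainEnd U bar σ₀) ≠ kpos U σ₀ := fun he =>
  chainEnd_ne h hU hb hσ₀ ((isKernelSlot_chainEnd h hU hb hσ₀).kpos_injective hσ₀ he)

omit h hU hb hσ₀ in
/-- **The length of a chain** is even, `2 (clen + 1) ≥ 2`. [folklore] -/
theorem length_chain : (chain U bar σ₀).length = 2 * (clen U bar σ₀ + 1) :=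
  length_flatMap_pair _ _ _

omit h hU hb hσ₀ in
/-- A chain is non-empty. [folklore] -/
theorem chain_ne_nil : chain U bar σ₀ ≠ [] := by
  rw [ne_eq, ← List.length_eq_zero_iff, length_chain]; omega

omit h hU hb hσ₀ in
/-- A chain has length at least `2`. [folklore] -/
theorem two_le_length_chain : 2 ≤ (chain U bar σ₀).length := by
  rw [length_chain]; omega

omit h hU hb hσ₀ in
/-- A chain has even length. [folklore] -/
theorem even_length_chain : Even (chain U bar σ₀).length :=
  ⟨clen U bar σ₀ + 1, by rw [length_chain]; ring⟩

omit h hU hb hσ₀ in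
/-- A chain starts `σ₀, fpartner σ₀, …`. [folklore] -/
theorem chain_eq_cons : chain U bar σ₀ = σ₀ :: fpartner U bar σ₀ ::
    (List.range (clen U bar σ₀)).flatMap fun i =>
      [citer U bar σ₀ (i + 1), fpartner U bar (citer U bar σ₀ (i + 1))] :=
  flatMap_pair_succ_eq_cons _ _ _

omit h hU hb hσ₀ in
/-- The even entries of a chain. [folklore] -/
theorem getElem?_chain_even {i : ℕ} (hi : i ≤ clen U bar σ₀) :
    (chain U bar σ₀)[2 * i]? = some (citer U bar σ₀ i) :=
  getElem?_flatMap_pair_even _ _ _ (Nat.lt_succ_of_le hi)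

omit h hU hb hσ₀ in
/-- The odd entries of a chain. [folklore] -/
theorem getElem?_chain_odd {i : ℕ} (hi : i ≤ clen U bar σ₀) :
    (chain U bar σ₀)[2 * i + 1]? = some (fpartner U bar (citer U bar σ₀ i)) :=
  getElem?_flatMap_pair_odd _ _ _ (Nat.lt_succ_of_le hi)

omit h hU hb hσ₀ in
/-- All entries of a chain, by parity of the index. [folklore] -/
theorem getElem?_chain {j : ℕ} (hj : j < (chain U bar σ₀).length) :
    (chain U bar σ₀)[j]? = some (if j % 2 = 0 then citer U bar σ₀ (j / 2)
      else fpartner U bar (citer U bar σ₀ (j / 2))) :=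
  getElem?_flatMap_pair _ _ _ _ (by rwa [length_chain] at hj)

omit h hU hb hσ₀ in
/-- All entries of a chain, by parity of the index (`getElem` form). [folklore] -/
theorem getElem_chain {j : ℕ} (hj : j < (chain U bar σ₀).length) :
    (chain U bar σ₀)[j] = if j % 2 = 0 then citer U bar σ₀ (j / 2)
      else fpartner U bar (citer U bar σ₀ (j / 2)) := by
  have e := getElem?_chain hj
  rwa [List.getElem?_eq_getElem hj, Option.some.injEq] at e

omit h hU hb hσ₀ in
/-- The first entry of a chain is `σ₀`. [folklore] -/
theorem head_chain : (chain U bar σ₀).head chain_ne_nil = σ₀ := by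
  simp only [chain_eq_cons, List.head_cons]

omit h hU hb hσ₀ in
/-- **The last entry of a chain is `chainEnd`.** [folklore] -/
theorem getLast_chain : (chain U bar σ₀).getLast chain_ne_nil = chainEnd U bar σ₀ :=
  getLast_flatMap_pair _ _ _ _

omit h hU hb hσ₀ in
/-- Membership in a chain. [folklore] -/
theorem mem_chain_iff {σ : ℕ × ℕ} : σ ∈ chain U bar σ₀ ↔
    ∃ i, i ≤ clen U bar σ₀ ∧ (σ = citer U bar σ₀ i ∨ σ = fpartner U bar (citer U bar σ₀ i)) := by
  rw [chain, mem_flatMap_pair_iff]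
  simp only [Nat.lt_succ_iff]

omit h hU hb hσ₀ in
/-- Membership in the even part of a chain. [folklore] -/
theorem mem_chainEvens_iff {σ : ℕ × ℕ} :
    σ ∈ chainEvens U bar σ₀ ↔ ∃ i, i ≤ clen U bar σ₀ ∧ citer U bar σ₀ i = σ := by
  simp only [chainEvens, List.mem_map, List.mem_range, Nat.lt_succ_iff]

omit h hU hb hσ₀ in
/-- Membership in the odd part of a chain. [folklore] -/
theorem mem_chainOdds_iff {σ : ℕ × ℕ} :
    σ ∈ chainOdds U bar σ₀ ↔ ∃ i, i ≤ clen U bar σ₀ ∧ fpartner U bar (citer U bar σ₀ i) = σ := by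
  simp only [chainOdds, List.mem_map, List.mem_range, Nat.lt_succ_iff]

omit h hU hb hσ₀ in
/-- A chain is the union of its even and odd parts. [folklore] -/
theorem mem_chain_iff_evens_or_odds {σ : ℕ × ℕ} :
    σ ∈ chain U bar σ₀ ↔ σ ∈ chainEvens U bar σ₀ ∨ σ ∈ chainOdds U bar σ₀ := by
  simp only [mem_chain_iff, mem_chainEvens_iff, mem_chainOdds_iff]
  constructor
  · rintro ⟨i, hi, rfl | rfl⟩
    · exact Or.inl ⟨i, hi, rfl⟩
    · exact Or.inr ⟨i, hi, rfl⟩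
  · rintro (⟨i, hi, rfl⟩ | ⟨i, hi, rfl⟩)
    · exact ⟨i, hi, Or.inl rfl⟩
    · exact ⟨i, hi, Or.inr rfl⟩

omit h hU hb hσ₀ in
/-- `σ₀` is an even entry of its chain. [folklore] -/
theorem self_mem_chainEvens : σ₀ ∈ chainEvens U bar σ₀ :=
  mem_chainEvens_iff.2 ⟨0, Nat.zero_le _, rfl⟩

omit h hU hb hσ₀ in
/-- `chainEnd` is an odd entry of the chain. [folklore] -/
theorem chainEnd_mem_chainOdds : chainEnd U bar σ₀ ∈ chainOdds U bar σ₀ :=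
  mem_chainOdds_iff.2 ⟨_, le_rfl, rfl⟩

/-- **All entries of a chain are slots.** [folklore] -/
theorem isSlot_of_mem_chain {σ : ℕ × ℕ} (hσ : σ ∈ chain U bar σ₀) : IsSlot U σ := by
  obtain ⟨i, hi, rfl | rfl⟩ := mem_chain_iff.1 hσ
  · exact isSlot_citer h hU hb hσ₀ hi
  · exact isSlot_fpartner_citer h hU hb hσ₀ hi

/-- **A chain has no repeated slot.** [cite: ZieschangVogtColdewey1980, proof of Thm. 5.3.2] -/
theorem nodup_chain : (chain U bar σ₀).Nodup :=
  nodup_flatMap_pair _ _ _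
    (fun _ _ hi hj => citer_ne_fpartner_citer h hU hb hσ₀ (Nat.le_of_lt_succ hi)
      (Nat.le_of_lt_succ hj))
    (fun _ _ hi hj e => citer_injective h hU hb hσ₀ (Nat.le_of_lt_succ hi) (Nat.le_of_lt_succ hj) e)
    (fun _ _ hi hj e => fpartner_citer_injective h hU hb hσ₀ (Nat.le_of_lt_succ hi)
      (Nat.le_of_lt_succ hj) e)

/-- The even and odd parts of a chain are disjoint. [folklore] -/
theorem not_mem_chainOdds_of_mem_chainEvens {σ : ℕ × ℕ} (he : σ ∈ chainEvens U bar σ₀) :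
    σ ∉ chainOdds U bar σ₀ := fun ho => by
  obtain ⟨i, hi, rfl⟩ := mem_chainEvens_iff.1 he
  obtain ⟨j, hj, e⟩ := mem_chainOdds_iff.1 ho
  exact citer_ne_fpartner_citer h hU hb hσ₀ hi hj e.symm

omit h hU hb hσ₀ in
/-- **Alternation (index form)**: each odd entry is the formal partner of the entry before it.
[cite: ZieschangVogtColdewey1980, proof of Thm. 5.3.2] -/
theorem getElem_chain_odd_eq_fpartner {i : ℕ} (hi : 2 * i + 1 < (chain U bar σ₀).length) :
    (chain U bar σ₀)[2 * i + 1] = fpartner U bar ((chain U bar σ₀)[2 * i]) := by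
  rw [getElem_chain, getElem_chain, if_neg (by omega), if_pos (by omega),
    show (2 * i + 1) / 2 = i by omega, show 2 * i / 2 = i by omega]

/-- **Alternation (index form)**: each even entry after the first is the cancelling partner of
the entry before it. [cite: ZieschangVogtColdewey1980, proof of Thm. 5.3.2] -/
theorem cpartner_getElem_chain_odd {i : ℕ} (hi : 2 * i + 2 < (chain U bar σ₀).length) :
    cpartner U ((chain U bar σ₀)[2 * i + 1]) = some ((chain U bar σ₀)[2 * i + 2]) := by
  rw [getElem_chain, getElem_chain, if_neg (by omega), if_pos (by omega),
    show (2 * i + 1) / 2 = i by omega, show (2 * i + 2) / 2 = i + 1 by omega]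
  rw [length_chain] at hi
  exact cpartner_fpartner_citer h hU hb hσ₀ (by omega)

/-- **Exactly the two ends of a chain are kernel slots**: interior entries are head or tail
slots. [cite: ZieschangVogtColdewey1980, proof of Thm. 5.3.2] -/
theorem not_isKernelSlot_getElem_chain {j : ℕ} (h0 : 0 < j) (hj : j + 1 < (chain U bar σ₀).length) :
    ¬ IsKernelSlot U ((chain U bar σ₀)[j]) := by
  rw [getElem_chain]
  rw [length_chain] at hj
  split_ifs with hp
  · exact not_isKernelSlot_citer h hU hb hσ₀ (by omega) (by omega)
  · exact not_isKernelSlot_fpartner_citer (by omega)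

/-- The ends of a chain are kernel slots (index form). [folklore] -/
theorem isKernelSlot_getElem_chain_iff {j : ℕ} (hj : j < (chain U bar σ₀).length) :
    IsKernelSlot U ((chain U bar σ₀)[j]) ↔ j = 0 ∨ j + 1 = (chain U bar σ₀).length := by
  constructor
  · intro hk
    by_contra hne
    exact not_isKernelSlot_getElem_chain h hU hb hσ₀ (j := j) (by omega) (by omega) hk
  · rintro (rfl | hlast)
    · simpa [getElem_chain] using hσ₀
    · rw [getElem_chain, if_neg (by rw [length_chain] at hlast; omega)]
      rw [length_chain] at hlast
      rw [show j / 2 = clen U bar σ₀ by omega]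
      exact isKernelSlot_chainEnd h hU hb hσ₀

/-- **Letters along a chain (index form)**: even entries carry the letter of `σ₀`, odd entries
its inverse. [cite: ZieschangVogtColdewey1980, proof of Thm. 5.3.2] -/
theorem slotLetter_getElem_chain [Inhabited α] {j : ℕ} (hj : j < (chain U bar σ₀).length) :
    slotLetter U ((chain U bar σ₀)[j]) = if j % 2 = 0 then slotLetter U σ₀
      else ((slotLetter U σ₀).1, !(slotLetter U σ₀).2) := by
  rw [getElem_chain]
  rw [length_chain] at hj
  split_ifs with hp
  · exact slotLetter_citer h hU hb hσ₀ (by omega)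
  · exact slotLetter_fpartner_citer h hU hb hσ₀ (by omega)

/-! ### Kernel slots on a chain, equivariance of the even/odd parts -/

/-- The only kernel slot among the even entries is `σ₀`. [folklore] -/
theorem eq_of_mem_chainEvens_of_isKernelSlot {σ : ℕ × ℕ} (he : σ ∈ chainEvens U bar σ₀)
    (hk : IsKernelSlot U σ) : σ = σ₀ := by
  obtain ⟨i, hi, rfl⟩ := mem_chainEvens_iff.1 he
  rcases Nat.eq_zero_or_pos i with rfl | h0
  · rfl
  · exact absurd hk (not_isKernelSlot_citer h hU hb hσ₀ h0 hi)

omit h hU hb hσ₀ in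
/-- The only kernel slot among the odd entries is `chainEnd`. [folklore] -/
theorem eq_of_mem_chainOdds_of_isKernelSlot {σ : ℕ × ℕ} (ho : σ ∈ chainOdds U bar σ₀)
    (hk : IsKernelSlot U σ) : σ = chainEnd U bar σ₀ := by
  obtain ⟨i, hi, rfl⟩ := mem_chainOdds_iff.1 ho
  rcases hi.lt_or_eq with hlt | rfl
  · exact absurd hk (not_isKernelSlot_fpartner_citer hlt)
  · rfl

/-- The formal partner exchanges the odd and even parts of a chain. [folklore] -/
theorem mem_chainOdds_iff_fpartner_mem_chainEvens {σ : ℕ × ℕ} (hσ : IsSlot U σ) :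
    σ ∈ chainOdds U bar σ₀ ↔ fpartner U bar σ ∈ chainEvens U bar σ₀ := by
  rw [mem_chainOdds_iff, mem_chainEvens_iff]
  constructor
  · rintro ⟨i, hi, rfl⟩
    exact ⟨i, hi, (hb.fpartner_fpartner (isSlot_citer h hU hb hσ₀ hi)).symm⟩
  · rintro ⟨i, hi, e⟩
    exact ⟨i, hi, by rw [e, hb.fpartner_fpartner hσ]⟩

/-- The formal partner exchanges the even and odd parts of a chain. [folklore] -/
theorem mem_chainEvens_iff_fpartner_mem_chainOdds {σ : ℕ × ℕ} (hσ : IsSlot U σ) :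
    σ ∈ chainEvens U bar σ₀ ↔ fpartner U bar σ ∈ chainOdds U bar σ₀ := by
  rw [mem_chainOdds_iff_fpartner_mem_chainEvens h hU hb hσ₀ (hb.isSlot_fpartner hσ),
    hb.fpartner_fpartner hσ]

/-- The cancelling partner exchanges the even and odd parts of a chain (head/tail slots).
[folklore] -/
theorem mem_chainEvens_iff_cget_mem_chainOdds {σ : ℕ × ℕ} (hσ : IsSlot U σ)
    (hk : ¬ IsKernelSlot U σ) : σ ∈ chainEvens U bar σ₀ ↔ cget U σ ∈ chainOdds U bar σ₀ := by
  rw [mem_chainOdds_iff, mem_chainEvens_iff]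
  constructor
  · rintro ⟨i, hi, rfl⟩
    rcases Nat.eq_zero_or_pos i with rfl | h0
    · exact absurd hσ₀ hk
    · obtain ⟨i, rfl⟩ : ∃ i', i = i' + 1 := ⟨i - 1, by omega⟩
      exact ⟨i, by omega, (cget_citer_succ h hU hb hσ₀ (by omega)).symm⟩
  · rintro ⟨i, hi, e⟩
    rcases hi.lt_or_eq with hlt | rfl
    · refine ⟨i + 1, by omega, ?_⟩
      rw [citer_succ, e, (h.cget_spec hU hσ hk).2.2]
    · exact absurd (isKernelSlot_chainEnd h hU hb hσ₀) (by
        rw [chainEnd, e]; exact (h.cget_spec hU hσ hk).2.1)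

/-- The cancelling partner exchanges the odd and even parts of a chain (head/tail slots).
[folklore] -/
theorem mem_chainOdds_iff_cget_mem_chainEvens {σ : ℕ × ℕ} (hσ : IsSlot U σ)
    (hk : ¬ IsKernelSlot U σ) : σ ∈ chainOdds U bar σ₀ ↔ cget U σ ∈ chainEvens U bar σ₀ := by
  obtain ⟨hσ', hk', e⟩ := h.cget_spec hU hσ hk
  rw [mem_chainEvens_iff_cget_mem_chainOdds h hU hb hσ₀ hσ' hk', e]

/-! ### Walking back from the far end -/

/-- Walking from the far end retraces the chain: `citer (chainEnd σ₀) i = f (citer σ₀ (n - i))`.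
[folklore] -/
theorem citer_chainEnd : ∀ {i : ℕ}, i ≤ clen U bar σ₀ →
    citer U bar (chainEnd U bar σ₀) i = fpartner U bar (citer U bar σ₀ (clen U bar σ₀ - i))
  | 0, _ => by rw [citer_zero, Nat.sub_zero]; rfl
  | i + 1, hi => by
    rw [citer_succ, citer_chainEnd (Nat.le_of_succ_le hi),
      hb.fpartner_fpartner (isSlot_citer h hU hb hσ₀ (Nat.sub_le _ _)),
      show clen U bar σ₀ - i = (clen U bar σ₀ - (i + 1)) + 1 by omega,
      cget_citer_succ h hU hb hσ₀ (by omega)]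

/-- The odd entries walking back: `f (citer (chainEnd σ₀) i) = citer σ₀ (n - i)`. [folklore] -/
theorem fpartner_citer_chainEnd {i : ℕ} (hi : i ≤ clen U bar σ₀) :
    fpartner U bar (citer U bar (chainEnd U bar σ₀) i) = citer U bar σ₀ (clen U bar σ₀ - i) := by
  rw [citer_chainEnd h hU hb hσ₀ hi, hb.fpartner_fpartner (isSlot_citer h hU hb hσ₀ (Nat.sub_le _ _))]

/-- The chain from the far end has the same length. [folklore] -/
theorem clen_chainEnd : clen U bar (chainEnd U bar σ₀) = clen U bar σ₀ := by
  apply (Nat.find_eq_iff _).2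
  refine ⟨Or.inl ?_, fun j hj => ?_⟩
  · rw [fpartner_citer_chainEnd h hU hb hσ₀ le_rfl, Nat.sub_self]
    exact hσ₀
  · rw [not_or]
    refine ⟨?_, ((hj.trans (clen_lt_nslots h hU hb hσ₀)).ne)⟩
    rw [fpartner_citer_chainEnd h hU hb hσ₀ hj.le]
    exact not_isKernelSlot_citer h hU hb hσ₀ (by omega) (Nat.sub_le _ _)

/-- **Walking back from the far end returns to `σ₀`**: `chainEnd` is an involution.
[cite: ZieschangVogtColdewey1980, proof of Thm. 5.3.2] -/
theorem chainEnd_chainEnd : chainEnd U bar (chainEnd U bar σ₀) = σ₀ := by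
  rw [chainEnd, clen_chainEnd h hU hb hσ₀, fpartner_citer_chainEnd h hU hb hσ₀ le_rfl, Nat.sub_self]
  rfl

/-- **The chain from the far end is the reversed chain.** [cite: ZieschangVogtColdewey1980, proof of Thm. 5.3.2] -/
theorem chain_chainEnd : chain U bar (chainEnd U bar σ₀) = (chain U bar σ₀).reverse := by
  rw [chain, chain, clen_chainEnd h hU hb hσ₀, reverse_flatMap_pair]
  refine List.flatMap_congr fun i hi => ?_
  rw [List.mem_range] at hi
  rw [fpartner_citer_chainEnd h hU hb hσ₀ (by omega), citer_chainEnd h hU hb hσ₀ (by omega)]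

end chainAPI

end CycFactors

end Literature.GroupTheory.CombinatorialGroupTheory
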